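import Summits.BirchSwinnertonDyer.BirchSwinnertonDyer.Theorems.CMKolyvaginAtInertTwoPairAssemblyOfPairDataAtTwo
import Summits.BirchSwinnertonDyer.BirchSwinnertonDyer.Theorems.CMKolyvaginAtInertTwoPairMemberCanonicalKolAtTwo
import Summits.BirchSwinnertonDyer.BirchSwinnertonDyer.Theorems.CMKolyvaginAtInertTwoPairOfRatDataAAtTwo
import Summits.BirchSwinnertonDyer.BirchSwinnertonDyer.Theorems.CMKolyvaginAtInertTwoPairDataInputsAtTwo
import Summits.BirchSwinnertonDyer.BirchSwinnertonDyer.Theorems.CMKolyvaginAtInertTwoFullOrderPairCebotarevSocketsAtTwo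
import Summits.BirchSwinnertonDyer.BirchSwinnertonDyer.Theorems.CMKolyvaginAtInertTwoPairAssemblyAbstractSideAtTwo
import Literature.NumberTheory.EllipticCurves.CasselsTateLevelAlternating
import Literature.NumberTheory.EllipticCurves.ArtinFormalismQuadraticLocalProofs
import Literature.NumberTheory.EllipticCurves.SelmerFiniteProofs
import HarnessLib

/-!
# Route `CMKolyvaginAtInertTwo`, crux `CMKolyvaginExactAtInertTwo` (stmt-BirchSwinnertonDyer-24277):
# THE PATH-(β) T2 ASSEMBLY WITH THE CANONICAL CASSELS–TATE MEMBER FORMULAS, AND ON THE HABITAT H₂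

Seat `bsd-line-cmk2-p1` g17 (cell `bsd-print-cf2`); helper (`--supports stmt-BirchSwinnertonDyer-24277`).
THEOREMS ONLY: no definition, no named fact, no `sorry`; no item is closed; BSD is not proved by this.
KERNEL-STATUS-p2-port.md §17.4–17.9. (1) `card_mul_card_le_two_pow_two_mul_of_pairData_canonical`: the assembly
`…_of_pairData` (p717813) with its two MEMBER FORMULAS discharged by `hV₁/hV₂_canonical_of_kol` (p717802), their
inputs (Lemma 4.3 over `ℚ`, Prop. 4.4 across) read off the two-member data `D` (`memberInputs_of_pairData`), and
the alternation by Cassels' theorem (`ctLevelPairing_self_eq_zero`). (2) `card_mul_card_le_two_pow_two_mul_of_pairData_cmInert`: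
ON H₂ (`W` CM, globally minimal, `CMInert W 2`, `ρ̄_{E,2}` onto; `K` imaginary quadratic, odd `d_K`, Heegner for `N_E`)
every non-data input is discharged — `Δ < 0`, `Δ ∉ K²`, the Cartan element (ty2 `CartanAtTwo.hcomm_of_habitat`),
complex conjugation, `K = ℚ(θ)`, `E(K)[2^{2L}] = 0` (Dokchitser–Dokchitser), Čebotarev (`chebotarev_artinRep_holds`),
`f = (res, ψ ∘ res)` (`exists_pairOfRat`), `hA` (p714773), the support bookkeeping `S := kolPrime W K (2L)`
(`kolPrime_of_isKolyvaginPrime_of_frobEqFrobInfty_succ`), finiteness of the Selmer groups, `ι₁` onto and the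
rank-zero consequences of an injective `ι₂` (p716506), `ord D.x = exp Sel`. REMAINING DISPLAYED INPUTS: the data `D`
(Kolyvagin's classes over `ℚ`; `D.Kol` the fixed predicate), a Heegner point, the Cassels–Tate data at level `2^L`
for both members, the rank-one kernel `ker ι₁ = ℤ·D.x` (tool: p718128), `ι₂` injective, and the NONDEGENERACY of the
two canonical pairings on `Ш[2^L]` (over `ℚ` at `2`: §17.8).
OUTPUT `#Ш(E)[2^L] · #Sel_{2^{2L}}(E^{(d_K)}) ≤ 2^{2·D.M₀}`.

References: [McCallumLMS1991] §1 Theorem, §4 Prop. 4.4, 4.7, §5 Lemma 5.3, Thm. 5.4, Cor. 5.6; [Kolyvagin1989Izv] §3;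
[GrossLMS1991] §3, §5 (5.1); [MilneADT2006] I §6 Prop. 6.9; [DokchitserDokchitserMathZ2012] Theorem (1).
-/


-- single-conjunct summit: `Summit.BirchSwinnertonDyer.BirchSwinnertonDyer.…` repeats the name by design
set_option linter.dupNamespace false
set_option autoImplicit false

noncomputable section

open scoped Classical
open scoped AddSubgroup
open WeierstrassCurve NumberField IsDedekindDomain Field Function Rat.HeightOneSpectrum
open Literature.NumberTheory.GaloisRepresentations
open Literature.NumberTheory.GaloisCohomology
open Literature.NumberTheory.EllipticCurves Literature.NumberTheory.EllipticCurves.KolyvaginDescent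
open Summit.BirchSwinnertonDyer.BirchSwinnertonDyer.Theorems.GenusExact.EigenClassesFinite
open Summit.BirchSwinnertonDyer.BirchSwinnertonDyer.Theorems.GenusExact.VisiblePairAtTwo
open Summit.BirchSwinnertonDyer.Rank1Residual.X11b.Three.Koly.Method2
  (LocalFrob.inertiaDeg_eq_two_of_isPrime_span LocalFrob.hasGoodReductionAt_rat_of_not_dvd_conductorNorm)

namespace Summit.BirchSwinnertonDyer.BirchSwinnertonDyer.Theorems.KolyvaginPairDataTwo

variable {N : ℕ} (W : WeierstrassCurve ℚ) {K : Type} [Field K] [NumberField K]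

/-! ## The member formulas' inputs read off the two-member data -/

/-- Lemma 4.3 over `ℚ` and Prop. 4.4 across, in gk2's currency, FROM the fields of two-member data `D`
whose local conditions, divisibility, places and strict conditions are `loc₁/loc₂`, `Dv`, `pl`, `a₁/a₂` and
whose prime is `2`. [cite: McCallumLMS1991, §4 Lemma 4.3, Prop. 4.4] -/
theorem memberInputs_of_pairData {M : ℕ}
    (D : PairDataM (galH1Torsion W (lvl M)) (galH1Torsion (twin W K) (lvl M))
      (HeightOneSpectrum (𝓞 ℚ) ⊕ InfinitePlace ℚ))
    (hDp : D.p = 2) (hDLoc₁ : D.Loc₁ = loc₁ W M) (hDLoc₂ : D.Loc₂ = loc₂ W K M)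
    (hDA₁ : D.A₁ = a₁ W M) (hDA₂ : D.A₂ = a₂ W K M) (hDpl : D.pl = pl) (hDDv : D.Dv = Dv) :
    (∀ m, KolSupp D.Kol m → Even m.primeFactors.card → ∀ v : HeightOneSpectrum (𝓞 ℚ),
        (m : 𝓞 ℚ) ∉ v.asIdeal → D.c₁ m ∈ selmerLocalKer W (v.adicCompletion ℚ) (lvl M)) ∧
      (∀ m, KolSupp D.Kol m → Even m.primeFactors.card →
        ∀ w : InfinitePlace ℚ, D.c₁ m ∈ selmerLocalKer W w.Completion (lvl M)) ∧
      (∀ m, KolSupp D.Kol m → Odd m.primeFactors.card → ∀ v : HeightOneSpectrum (𝓞 ℚ),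
        (m : 𝓞 ℚ) ∉ v.asIdeal → D.c₂ m ∈ selmerLocalKer (twin W K) (v.adicCompletion ℚ) (lvl M)) ∧
      (∀ m, KolSupp D.Kol m → Odd m.primeFactors.card →
        ∀ w : InfinitePlace ℚ, D.c₂ m ∈ selmerLocalKer (twin W K) w.Completion (lvl M)) ∧
      (∀ ℓ m : ℕ, D.Kol ℓ → KolSupp D.Kol (ℓ * m) → Odd m.primeFactors.card → ∀ a : ℕ,
        ((2 : ℤ) ^ a) • D.c₁ (ℓ * m) ∈ loc₁ W M (pl ℓ) ↔ ((2 : ℤ) ^ a) • D.c₂ m ∈ a₂ W K M ℓ) ∧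
      (∀ ℓ m : ℕ, D.Kol ℓ → KolSupp D.Kol (ℓ * m) → Even m.primeFactors.card → ∀ a : ℕ,
        ((2 : ℤ) ^ a) • D.c₂ (ℓ * m) ∈ loc₂ W K M (pl ℓ) ↔ ((2 : ℤ) ^ a) • D.c₁ m ∈ a₁ W M ℓ) := by
  have hpZ : ((D.p : ℕ) : ℤ) = 2 := by rw [hDp, Nat.cast_ofNat]
  refine ⟨fun m hm hev v hv ↦ ?_, fun m hm hev w ↦ ?_, fun m hm hodd v hv ↦ ?_, fun m hm hodd w ↦ ?_,
    fun ℓ m hℓ hs hodd a ↦ ?_, fun ℓ m hℓ hs hev a ↦ ?_⟩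
  · have h := D.c_mem_loc₁ m hm hev (Sum.inl v) (by rw [hDDv]; exact hv)
    rw [hDLoc₁] at h
    exact h
  · have h := D.c_mem_loc₁ m hm hev (Sum.inr w) (by rw [hDDv]; exact not_false)
    rw [hDLoc₁] at h
    exact h
  · have h := D.c_mem_loc₂ m hm hodd (Sum.inl v) (by rw [hDDv]; exact hv)
    rw [hDLoc₂] at h
    exact h
  · have h := D.c_mem_loc₂ m hm hodd (Sum.inr w) (by rw [hDDv]; exact not_false)
    rw [hDLoc₂] at h
    exact h
  · have h := D.c_mem_loc_iff₂₁ ℓ m hℓ hs hodd a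
    rw [hpZ, hDLoc₁, hDpl, hDA₂] at h
    exact h
  · have h := D.c_mem_loc_iff₁₂ ℓ m hℓ hs hev a
    rw [hpZ, hDLoc₂, hDpl, hDA₁] at h
    exact h

/-! ## The assembly with the canonical member formulas -/

set_option maxHeartbeats 1600000 in
/-- **McCallum's inequality `#Ш(E/ℚ)[2^L] · #Sel_{2^{2L}}(E^{(d_K)}/ℚ) ≤ 2^{2M₀}` on the `ℚ`-pair carrier, with
the canonical Cassels–Tate member formulas plugged in** — from the two-member descent data `D`, the map `f`
with `hA`, the habitat, the Cassels–Tate data of `E` and `E^{(d_K)}` at level `2^L`, and the rank / finiteness /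
nondegeneracy facts of the abstract side (alternation is discharged: Cassels' theorem `ctLevelPairing_self_eq_zero`). [cite: McCallumLMS1991, §5 Thm. 5.4 (proof, p. 307), Cor. 5.6]
[cite: Kolyvagin1989Izv, §3] [cite: MilneADT2006, Ch. I §6 Prop. 6.9] -/
theorem card_mul_card_le_two_pow_two_mul_of_pairData_canonical
    (hC : Literature.NumberTheory.Automorphic.chebotarev_artinRep)
    [NeZero N] [W.IsElliptic] [W.IsGloballyMinimal] [(twin W K).IsElliptic]
    (hK : IsImaginaryQuadratic K) (hoddK : Odd (NumberField.discr K))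
    (hρ : W.HasSurjectiveModNGaloisRep 2) (hΔ : W.Δ < 0) (hΔK : ¬ IsSquare (W.baseChange K).Δ)
    (h2 : Module.finrank ℚ K = 2) {θ : K} (hθ : θ ∉ Set.range (algebraMap ℚ K))
    (hd : θ ^ 2 = algebraMap ℚ K ((NumberField.discr K : ℤ) : ℚ)) {L : ℕ} (hL1 : 1 ≤ L)
    [NeZero (2 ^ L * 2 ^ L)]
    {c₀ : absoluteGaloisGroup ℚ} (hc₀ : IsComplexConjugation (Rat.castHom ℝ) c₀)
    {z : absoluteGaloisGroup K}
    (hzfix : ∀ P : geomTorsion (W.baseChange K) ((2 : ℕ) : ℤ), z • P = P → P = 0)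
    (hcomm : ∀ π ∈ torsionFixing (W.baseChange K) ((2 : ℕ) : ℤ),
      ∀ P : geomTorsion (W.baseChange K) ((2 ^ (L + L + 1) : ℕ) : ℤ), π • z • P = z • π • P)
    {S : ℕ → Prop}
    (hS : ∀ ℓ, IsKolyvaginPrime N W K 2 ℓ → FrobEqFrobInfty W K (2 ^ (L + L + 1)) ℓ → S ℓ)
    {P₀ : (W.baseChange K).toAffine.Point} (hP₀ : IsHeegnerPoint N W K P₀)
    (hnoTors : ∀ P : (W.baseChange K).toAffine.Point, ((2 ^ (L + L) : ℕ) : ℤ) • P = 0 → P = 0)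
    -- the two-member descent data on the `ℚ`-pair carrier
    (D : PairDataM (galH1Torsion W (lvl (L + L))) (galH1Torsion (twin W K) (lvl (L + L)))
      (HeightOneSpectrum (𝓞 ℚ) ⊕ InfinitePlace ℚ))
    (hDp : D.p = 2) (hDM : D.M = L + L)
    (hDSel₁ : D.Sel₁ = selmerGroup W (lvl (L + L)))
    (hDSel₂ : D.Sel₂ = selmerGroup (twin W K) (lvl (L + L)))
    (hDLoc₁ : D.Loc₁ = loc₁ W (L + L)) (hDLoc₂ : D.Loc₂ = loc₂ W K (L + L))
    (hDA₁ : D.A₁ = a₁ W (L + L)) (hDA₂ : D.A₂ = a₂ W K (L + L))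
    (hDpl : D.pl = pl) (hDDv : D.Dv = Dv)
    (hDKol : ∀ ℓ, D.Kol ℓ ↔ IsKolyvaginPrime N W K 2 ℓ ∧ FrobEqFrobInfty W K (2 ^ (L + L + 1)) ℓ ∧ S ℓ)
    (hKolk : ∀ ℓ, D.Kol ℓ → kolPrime W K (L + L) ℓ)
    (hM₀L : D.M₀ ≤ L)
    -- the map into the eigen-pair and the local compatibility at Kolyvagin primes
    (f : galH1Torsion W (lvl (L + L)) × galH1Torsion (twin W K) (lvl (L + L)) →+
      PairV W (sigmaQ K h2 hθ hd) (L + L) 1)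
    (hf : Function.Injective f)
    (hf₁ : ∀ v, ((f v).1 : galH1Torsion (W.baseChange K) ((2 ^ (L + L) : ℕ) : ℤ)) =
      resTorsion W K (lvl (L + L)) v.1)
    (hf₂ : ∀ v, ((f v).2 : galH1Torsion (W.baseChange K) ((2 ^ (L + L) : ℕ) : ℤ)) =
      hPsiKT W K hθ hd (lvl (L + L)) (resTorsion (twin W K) K (lvl (L + L)) v.2))
    (hA : ∀ ℓ, D.Kol ℓ → ∀ v, v ∈ D.toSplitData.A ℓ ↔ f v ∈ pairA (N := N) W (sigmaQ K h2 hθ hd) (L + L) 1 ℓ)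
    -- the Cassels–Tate data of `E` at level `2^L`
    (hkill₁ : ∀ a ∈ W.sha, ((2 : ℤ) ^ (2 * L)) • a = 0 → ((2 : ℤ) ^ L) • a = 0)
    (e₁ : geomTorsion W ((2 ^ L * 2 ^ L : ℕ) : ℤ) → geomTorsion W ((2 ^ L * 2 ^ L : ℕ) : ℤ) → AlgebraicClosure ℚ)
    (hμ₁ : ∀ S T, e₁ S T ^ (2 ^ L * 2 ^ L) = 1)
    (hadd₁₁ : ∀ S₁ S₂ T, e₁ (S₁ + S₂) T = e₁ S₁ T * e₁ S₂ T)
    (hadd₂₁ : ∀ S T₁ T₂, e₁ S (T₁ + T₂) = e₁ S T₁ * e₁ S T₂)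
    (hgal₁ : ∀ (σ : absoluteGaloisGroup ℚ) (S T : geomTorsion W ((2 ^ L * 2 ^ L : ℕ) : ℤ)),
      σ • e₁ S T = e₁ (σ • S) (σ • T))
    (halt₁ : ∀ T, e₁ T T = 1) (hnondeg₁ : ∀ T, (∀ S, e₁ S T = 1) → T = 0)
    (ι₁ : selmerGroup W (lvl (L + L)) →+ (W.sha)[(2 ^ L : ℕ)])
    (hι₁ : ∀ z, shaTorsionVal W (2 ^ L) (ι₁ z) = torsionH1ToH1 W (lvl (L + L)) z)
    -- the Cassels–Tate data of `E^{(d_K)}` at level `2^L`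
    (hkill₂ : ∀ a ∈ (twin W K).sha, ((2 : ℤ) ^ (2 * L)) • a = 0 → ((2 : ℤ) ^ L) • a = 0)
    (e₂ : geomTorsion (twin W K) ((2 ^ L * 2 ^ L : ℕ) : ℤ) → geomTorsion (twin W K) ((2 ^ L * 2 ^ L : ℕ) : ℤ) →
      AlgebraicClosure ℚ)
    (hμ₂ : ∀ S T, e₂ S T ^ (2 ^ L * 2 ^ L) = 1)
    (hadd₁₂ : ∀ S₁ S₂ T, e₂ (S₁ + S₂) T = e₂ S₁ T * e₂ S₂ T)
    (hadd₂₂ : ∀ S T₁ T₂, e₂ S (T₁ + T₂) = e₂ S T₁ * e₂ S T₂)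
    (hgal₂ : ∀ (σ : absoluteGaloisGroup ℚ) (S T : geomTorsion (twin W K) ((2 ^ L * 2 ^ L : ℕ) : ℤ)),
      σ • e₂ S T = e₂ (σ • S) (σ • T))
    (halt₂ : ∀ T, e₂ T T = 1) (hnondeg₂ : ∀ T, (∀ S, e₂ S T = 1) → T = 0)
    (ι₂ : selmerGroup (twin W K) (lvl (L + L)) →+ ((twin W K).sha)[(2 ^ L : ℕ)])
    (hι₂ : ∀ z, shaTorsionVal (twin W K) (2 ^ L) (ι₂ z) = torsionH1ToH1 (twin W K) (lvl (L + L)) z)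
    -- the abstract `ℚ`-side
    [Finite (selmerGroup W (lvl (L + L)))] [Finite (selmerGroup (twin W K) (lvl (L + L)))]
    (hι₁surj : Function.Surjective ι₁) (x₁ : selmerGroup W (lvl (L + L)))
    (hx₁ : (x₁ : galH1Torsion W (lvl (L + L))) = D.x)
    (hker : ι₁.ker = AddSubgroup.zmultiples x₁)
    (hxord : addOrderOf x₁ = AddMonoid.exponent (selmerGroup W (lvl (L + L))))
    (hB₁nd : ∀ a : (W.sha)[(2 ^ L : ℕ)], (∀ b,
      ctLevelPairing W (2 ^ L) e₁ hμ₁ hadd₁₁ hadd₂₁ hgal₁ (LocalInvariants.canonical ℚ (2 ^ L * 2 ^ L)) halt₁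
        (sumInvLocalizationEqZero_canonical_of_numberField ℚ (2 ^ L * 2 ^ L)) (shaThree_mu_eq_zero ℚ (2 ^ L * 2 ^ L))
        (localTerm_finite_support (W := W) (m := 2 ^ L) (e := e₁) (hμ := hμ₁) (hadd₁ := hadd₁₁) (hadd₂ := hadd₂₁)
          (hgal := hgal₁) halt₁ (LocalInvariants.canonical ℚ (2 ^ L * 2 ^ L))) a b = 0) → a = 0)
    (hB₂nd : ∀ v : selmerGroup (twin W K) (lvl (L + L)), (∀ w,
      ctLevelPairing (twin W K) (2 ^ L) e₂ hμ₂ hadd₁₂ hadd₂₂ hgal₂ (LocalInvariants.canonical ℚ (2 ^ L * 2 ^ L))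
        halt₂ (sumInvLocalizationEqZero_canonical_of_numberField ℚ (2 ^ L * 2 ^ L))
        (shaThree_mu_eq_zero ℚ (2 ^ L * 2 ^ L))
        (localTerm_finite_support (W := twin W K) (m := 2 ^ L) (e := e₂) (hμ := hμ₂) (hadd₁ := hadd₁₂)
          (hadd₂ := hadd₂₂) (hgal := hgal₂) halt₂ (LocalInvariants.canonical ℚ (2 ^ L * 2 ^ L)))
        (ι₂ v) (ι₂ w) = 0) → v = 0)
    (hpB : ∀ v : selmerGroup (twin W K) (lvl (L + L)), 2 ^ L • v = 0) :
    Nat.card ((W.sha)[(2 ^ L : ℕ)]) * Nat.card (selmerGroup (twin W K) (lvl (L + L))) ≤ 2 ^ (2 * D.M₀) := by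
  obtain ⟨loc_c₁_fin, loc_c₁_inf, loc_c₂_fin, loc_c₂_inf, h44₂₁, h44₁₂⟩ :=
    memberInputs_of_pairData W D hDp hDLoc₁ hDLoc₂ hDA₁ hDA₂ hDpl hDDv
  -- the two canonical member formulas (support `D.Kol`, kill clause `2^L • t = 0`, `M₀ := D.M₀`)
  have hV₁ := hV₁_canonical_of_kol (W := W) (K := K) D.c₁ D.c₂ hΔ hρ hM₀L hL1 D.Kol hKolk hkill₁ loc_c₁_fin
    loc_c₁_inf h44₂₁ e₁ hμ₁ hadd₁₁ hadd₂₁ hgal₁ halt₁ hnondeg₁ ι₁ hι₁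
  have hV₂ := hV₂_canonical_of_kol (W := W) (K := K) D.c₁ D.c₂ hK hoddK hΔ hρ hM₀L hL1 D.Kol hKolk hkill₂
    loc_c₂_fin loc_c₂_inf h44₁₂ e₂ hμ₂ hadd₁₂ hadd₂₂ hgal₂ halt₂ hnondeg₂ ι₂ hι₂
  -- the two pairings are alternating (Cassels' theorem, `ctLevelPairing_self_eq_zero`)
  have hB₁alt : ∀ a : (W.sha)[(2 ^ L : ℕ)],
      ctLevelPairing W (2 ^ L) e₁ hμ₁ hadd₁₁ hadd₂₁ hgal₁ (LocalInvariants.canonical ℚ (2 ^ L * 2 ^ L)) halt₁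
        (sumInvLocalizationEqZero_canonical_of_numberField ℚ (2 ^ L * 2 ^ L)) (shaThree_mu_eq_zero ℚ (2 ^ L * 2 ^ L))
        (localTerm_finite_support (W := W) (m := 2 ^ L) (e := e₁) (hμ := hμ₁) (hadd₁ := hadd₁₁) (hadd₂ := hadd₂₁)
          (hgal := hgal₁) halt₁ (LocalInvariants.canonical ℚ (2 ^ L * 2 ^ L))) a a = 0 :=
    fun a ↦ ctLevelPairing_self_eq_zero W (2 ^ L) e₁ hμ₁ hadd₁₁ hadd₂₁ hgal₁ _ halt₁ _ _ _ a
  have hB₂alt : ∀ v : selmerGroup (twin W K) (lvl (L + L)),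
      ctLevelPairing (twin W K) (2 ^ L) e₂ hμ₂ hadd₁₂ hadd₂₂ hgal₂ (LocalInvariants.canonical ℚ (2 ^ L * 2 ^ L))
        halt₂ (sumInvLocalizationEqZero_canonical_of_numberField ℚ (2 ^ L * 2 ^ L))
        (shaThree_mu_eq_zero ℚ (2 ^ L * 2 ^ L))
        (localTerm_finite_support (W := twin W K) (m := 2 ^ L) (e := e₂) (hμ := hμ₂) (hadd₁ := hadd₁₂)
          (hadd₂ := hadd₂₂) (hgal := hgal₂) halt₂ (LocalInvariants.canonical ℚ (2 ^ L * 2 ^ L)))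
        (ι₂ v) (ι₂ v) = 0 :=
    fun v ↦ ctLevelPairing_self_eq_zero (twin W K) (2 ^ L) e₂ hμ₂ hadd₁₂ hadd₂₂ hgal₂ _ halt₂ _ _ _ (ι₂ v)
  exact card_mul_card_le_two_pow_two_mul_of_pairData W hC hK hρ hΔ hΔK h2 hθ hd hc₀ hzfix hcomm hS hP₀ hnoTors D
    hDp hDM hDSel₁ hDSel₂ hDA₁ hDA₂ hDKol hM₀L f hf hf₁ hf₂ hA _ ι₁ hV₁ _ ι₂ hV₂ hι₁surj x₁ hx₁ hker hxord
    hB₁alt hB₁nd hB₂alt hB₂nd hpB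

/-! ## The support bookkeeping: deep Gross-form Kolyvagin primes are `kolPrime` of the carrier depth -/

/-- **Every Gross-form Kolyvagin prime `ℓ` of `(E, K, 2)` for `N_E` with `Frob_ℓ ∼ τ` on `E[2^{M+1}]` is a
`kolPrime W K M ℓ`** (`K` quadratic, `E` globally minimal, `1 ≤ M`): `ℓ` odd, `ℓ ∤ d_K`, good reduction
(`ℓ ∤ N_E`), `Frob_ℓ ∼ τ` on `E[2^M]` and on `E[2]`, Kolyvagin index `≥ M`, and `ℓ` inert in `K`.
[cite: GrossLMS1991, §3 (3.1)–(3.3)] [cite: McCallumLMS1991, §3] -/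
theorem kolPrime_of_isKolyvaginPrime_of_frobEqFrobInfty_succ [W.IsElliptic] [W.IsGloballyMinimal]
    [NeZero (W.conductorNorm ℤ)] (h2 : Module.finrank ℚ K = 2) {M : ℕ} (hM : 1 ≤ M) {ℓ : ℕ}
    (hℓ : IsKolyvaginPrime (W.conductorNorm ℤ) W K 2 ℓ) (hfrob : FrobEqFrobInfty W K (2 ^ (M + 1)) ℓ) :
    kolPrime W K M ℓ := by
  obtain ⟨hℓp, hℓN, hℓD, hℓ2, hℓP, hfrob2⟩ := hℓ
  haveI : Fact ℓ.Prime := ⟨hℓp⟩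
  set v : HeightOneSpectrum (𝓞 ℚ) := primesEquiv.symm ⟨ℓ, hℓp⟩ with hv
  have hℓv : (ℓ : 𝓞 ℚ) ∈ v.asIdeal := natCast_mem_primesEquiv_symm hℓp
  have hvℓ : (primesEquiv v : ℕ) = ℓ := primesEquiv_eq_of_natCast_mem hℓp hℓv
  have hgood₁ : W.HasGoodReductionAt v := LocalFrob.hasGoodReductionAt_rat_of_not_dvd_conductorNorm W hℓp hℓN v hℓv
  have hgood : W.HasGoodReductionAtPrime ℓ := (hasGoodReductionAtPrime_primesEquiv_iff_holds W v ℓ hvℓ).mpr hgood₁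
  have hfrobM : FrobEqFrobInfty W K (2 ^ M) ℓ :=
    FrobEqFrobInfty.of_dvd (W := W) (K := K) (pow_dvd_pow 2 (Nat.le_succ M)) hfrob
  have hidx : M ≤ Zhang2014.kolyvaginIndex W 2 ℓ :=
    McCallum1991.le_kolyvaginIndex_of_frobEqFrobInfty W K Nat.prime_two hM hℓp hℓ2 hℓN hfrobM
  exact ⟨hℓp, hℓ2, hℓD, hgood, hfrobM, hfrob2, hidx,
    fun w hw ↦ LocalFrob.inertiaDeg_eq_two_of_isPrime_span K h2 hℓp hℓP w hw⟩

/-! ## The assembly on H₂ -/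

set_option maxHeartbeats 1600000 in
/-- **McCallum's inequality `#Ш(E/ℚ)[2^L] · #Sel_{2^{2L}}(E^{(d_K)}/ℚ) ≤ 2^{2M₀}` on H₂**, path (β), every habitat
binder, the map `f`, `hA` and the Kolyvagin-prime bookkeeping discharged (module docstring); displayed: the
two-member data `D` with its rfl-compatibilities (`D.Kol` = Gross-form Kolyvagin primes of depth `2L+1` that are
`kolPrime` of depth `2L`), a Heegner point, the Cassels–Tate data at level `2^L` for both members, and the abstract
rank / finiteness / nondegeneracy facts. [cite: McCallumLMS1991, §5 Thm. 5.4 (proof, p. 307), Cor. 5.6]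
[cite: Kolyvagin1989Izv, §3] [cite: GrossLMS1991, §5 (5.1)] -/
theorem card_mul_card_le_two_pow_two_mul_of_pairData_cmInert
    [W.IsElliptic] [W.IsGloballyMinimal] [NeZero (W.conductorNorm ℤ)] [(twin W K).IsElliptic]
    (hCM : W.HasCM) (hin : Literature.NumberTheory.EllipticCurves.Rank1Residual.CMInert W 2)
    (hρ : W.HasSurjectiveModNGaloisRep 2) (hK : IsImaginaryQuadratic K) (hoddK : Odd (NumberField.discr K))
    (hH : SatisfiesHeegnerHypothesis (W.conductorNorm ℤ) K)
    {P₀ : (W.baseChange K).toAffine.Point} (hP₀ : IsHeegnerPoint (W.conductorNorm ℤ) W K P₀)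
    {L : ℕ} (hL1 : 1 ≤ L)
    -- the two-member descent data on the `ℚ`-pair carrier
    (D : PairDataM (galH1Torsion W (lvl (L + L))) (galH1Torsion (twin W K) (lvl (L + L)))
      (HeightOneSpectrum (𝓞 ℚ) ⊕ InfinitePlace ℚ))
    (hDp : D.p = 2) (hDM : D.M = L + L)
    (hDSel₁ : D.Sel₁ = selmerGroup W (lvl (L + L)))
    (hDSel₂ : D.Sel₂ = selmerGroup (twin W K) (lvl (L + L)))
    (hDLoc₁ : D.Loc₁ = loc₁ W (L + L)) (hDLoc₂ : D.Loc₂ = loc₂ W K (L + L))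
    (hDA₁ : D.A₁ = a₁ W (L + L)) (hDA₂ : D.A₂ = a₂ W K (L + L))
    (hDpl : D.pl = pl) (hDDv : D.Dv = Dv)
    (hDKol : ∀ ℓ, D.Kol ℓ ↔ IsKolyvaginPrime (W.conductorNorm ℤ) W K 2 ℓ ∧
      FrobEqFrobInfty W K (2 ^ (L + L + 1)) ℓ ∧ kolPrime W K (L + L) ℓ)
    (hM₀L : D.M₀ ≤ L)
    -- the Cassels–Tate data of `E` at level `2^L`
    (hkill₁ : ∀ a ∈ W.sha, ((2 : ℤ) ^ (2 * L)) • a = 0 → ((2 : ℤ) ^ L) • a = 0)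
    (e₁ : geomTorsion W ((2 ^ L * 2 ^ L : ℕ) : ℤ) → geomTorsion W ((2 ^ L * 2 ^ L : ℕ) : ℤ) → AlgebraicClosure ℚ)
    (hμ₁ : ∀ S T, e₁ S T ^ (2 ^ L * 2 ^ L) = 1)
    (hadd₁₁ : ∀ S₁ S₂ T, e₁ (S₁ + S₂) T = e₁ S₁ T * e₁ S₂ T)
    (hadd₂₁ : ∀ S T₁ T₂, e₁ S (T₁ + T₂) = e₁ S T₁ * e₁ S T₂)
    (hgal₁ : ∀ (σ : absoluteGaloisGroup ℚ) (S T : geomTorsion W ((2 ^ L * 2 ^ L : ℕ) : ℤ)),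
      σ • e₁ S T = e₁ (σ • S) (σ • T))
    (halt₁ : ∀ T, e₁ T T = 1) (hnondeg₁ : ∀ T, (∀ S, e₁ S T = 1) → T = 0)
    (ι₁ : selmerGroup W (lvl (L + L)) →+ (W.sha)[(2 ^ L : ℕ)])
    (hι₁ : ∀ z, shaTorsionVal W (2 ^ L) (ι₁ z) = torsionH1ToH1 W (lvl (L + L)) z)
    -- the Cassels–Tate data of `E^{(d_K)}` at level `2^L`
    (hkill₂ : ∀ a ∈ (twin W K).sha, ((2 : ℤ) ^ (2 * L)) • a = 0 → ((2 : ℤ) ^ L) • a = 0)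
    (e₂ : geomTorsion (twin W K) ((2 ^ L * 2 ^ L : ℕ) : ℤ) → geomTorsion (twin W K) ((2 ^ L * 2 ^ L : ℕ) : ℤ) →
      AlgebraicClosure ℚ)
    (hμ₂ : ∀ S T, e₂ S T ^ (2 ^ L * 2 ^ L) = 1)
    (hadd₁₂ : ∀ S₁ S₂ T, e₂ (S₁ + S₂) T = e₂ S₁ T * e₂ S₂ T)
    (hadd₂₂ : ∀ S T₁ T₂, e₂ S (T₁ + T₂) = e₂ S T₁ * e₂ S T₂)
    (hgal₂ : ∀ (σ : absoluteGaloisGroup ℚ) (S T : geomTorsion (twin W K) ((2 ^ L * 2 ^ L : ℕ) : ℤ)),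
      σ • e₂ S T = e₂ (σ • S) (σ • T))
    (halt₂ : ∀ T, e₂ T T = 1) (hnondeg₂ : ∀ T, (∀ S, e₂ S T = 1) → T = 0)
    (ι₂ : selmerGroup (twin W K) (lvl (L + L)) →+ ((twin W K).sha)[(2 ^ L : ℕ)])
    (hι₂ : ∀ z, shaTorsionVal (twin W K) (2 ^ L) (ι₂ z) = torsionH1ToH1 (twin W K) (lvl (L + L)) z)
    -- the abstract `ℚ`-side (the two Selmer groups are finite: `finite_selmerGroup_holds`)
    -- the rank-one member: the kernel of `ι₁` is `ℤ · D.x` (Mordell–Weil rank one, `E(ℚ)[2] = 0`, `D.x = δ(x₀)` with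
    -- `x₀` an odd multiple of the generator modulo torsion: `…PairAssemblyRankOneSideAtTwo`)
    (hker : ∀ z : selmerGroup W (lvl (L + L)),
      ι₁ z = 0 ↔ (z : galH1Torsion W (lvl (L + L))) ∈ AddSubgroup.zmultiples D.x)
    -- the rank-zero member: `ι₂` injective (`E^{(d_K)}(ℚ)` finite without `2`-torsion, `Ш(E^{(d_K)})[2^{2L}] = Ш[2^L]`)
    (hι₂inj : Function.Injective ι₂)
    (hB₁nd : haveI : NeZero (2 ^ L * 2 ^ L) := ⟨by positivity⟩
      ∀ a : (W.sha)[(2 ^ L : ℕ)], (∀ b,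
      ctLevelPairing W (2 ^ L) e₁ hμ₁ hadd₁₁ hadd₂₁ hgal₁ (LocalInvariants.canonical ℚ (2 ^ L * 2 ^ L)) halt₁
        (sumInvLocalizationEqZero_canonical_of_numberField ℚ (2 ^ L * 2 ^ L)) (shaThree_mu_eq_zero ℚ (2 ^ L * 2 ^ L))
        (localTerm_finite_support (W := W) (m := 2 ^ L) (e := e₁) (hμ := hμ₁) (hadd₁ := hadd₁₁) (hadd₂ := hadd₂₁)
          (hgal := hgal₁) halt₁ (LocalInvariants.canonical ℚ (2 ^ L * 2 ^ L))) a b = 0) → a = 0)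
    (hCT₂nd : haveI : NeZero (2 ^ L * 2 ^ L) := ⟨by positivity⟩
      ∀ a : ((twin W K).sha)[(2 ^ L : ℕ)], (∀ b,
      ctLevelPairing (twin W K) (2 ^ L) e₂ hμ₂ hadd₁₂ hadd₂₂ hgal₂ (LocalInvariants.canonical ℚ (2 ^ L * 2 ^ L))
        halt₂ (sumInvLocalizationEqZero_canonical_of_numberField ℚ (2 ^ L * 2 ^ L))
        (shaThree_mu_eq_zero ℚ (2 ^ L * 2 ^ L))
        (localTerm_finite_support (W := twin W K) (m := 2 ^ L) (e := e₂) (hμ := hμ₂) (hadd₁ := hadd₁₂)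
          (hadd₂ := hadd₂₂) (hgal := hgal₂) halt₂ (LocalInvariants.canonical ℚ (2 ^ L * 2 ^ L))) a b = 0) → a = 0) :
    Nat.card ((W.sha)[(2 ^ L : ℕ)]) * Nat.card (selmerGroup (twin W K) (lvl (L + L))) ≤ 2 ^ (2 * D.M₀) := by
  haveI : NeZero (2 ^ L * 2 ^ L) := ⟨by positivity⟩
  haveI : Fact (Nat.Prime 2) := ⟨Nat.prime_two⟩
  -- ### the habitat inputs
  have h2 : Module.finrank ℚ K = 2 := hK.1
  have hΔ : W.Δ < 0 := KolyvaginEigenTwo.Δ_neg_of_cmInert_two W hCM hin hρ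
  have hΔK : ¬ IsSquare (W.baseChange K).Δ := by
    have h : (W.baseChange K).Δ = algebraMap ℚ K W.Δ := by rw [baseChange, map_Δ]
    rw [h]
    exact KolyvaginImageTwo.not_isSquare_algebraMap_Δ_of_cmInert_two_of_heegner W hCM hin hρ K hK hH
  obtain ⟨z, -, hzfix⟩ := KolyvaginImageTwo.exists_smul_three_of_hasSurjectiveModNGaloisRep W K h2 hρ
  have hcomm : ∀ π ∈ torsionFixing (W.baseChange K) ((2 : ℕ) : ℤ),
      ∀ P : geomTorsion (W.baseChange K) ((2 ^ (L + L + 1) : ℕ) : ℤ), π • z • P = z • π • P :=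
    Summit.BirchSwinnertonDyer.Rank1Residual.P2.CartanAtTwo.hcomm_of_habitat W K hCM hin hρ hzfix
  obtain ⟨c₀, hc₀⟩ := exists_isComplexConjugation (Rat.castHom ℝ)
  obtain ⟨θ, hθ, hd⟩ := Literature.NumberTheory.EllipticCurves.exists_sq_eq_discr_not_mem_range K h2
  have h2tors : ∀ P : (W.baseChange K).toAffine.Point, (2 : ℤ) • P = 0 → P = 0 := by
    intro P hP
    refine forall_two_nsmul_baseChange_of_hasSurjectiveModNGaloisRep_two_of_isImaginaryQuadratic W hρ K hK P ?_
    rw [← natCast_zsmul]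
    exact hP
  have hnoTors : ∀ P : (W.baseChange K).toAffine.Point, ((2 ^ (L + L) : ℕ) : ℤ) • P = 0 → P = 0 := by
    intro P hP
    refine eq_zero_of_two_pow_zsmul_eq_zero h2tors (L + L) P ?_
    rw [← Nat.cast_ofNat, ← Nat.cast_pow]
    exact hP
  -- ### the support bookkeeping `S := kolPrime W K (2L)`
  have hS : ∀ ℓ, IsKolyvaginPrime (W.conductorNorm ℤ) W K 2 ℓ → FrobEqFrobInfty W K (2 ^ (L + L + 1)) ℓ →
      kolPrime W K (L + L) ℓ :=
    fun ℓ hℓ hfrob ↦ kolPrime_of_isKolyvaginPrime_of_frobEqFrobInfty_succ W h2 (by omega) hℓ hfrob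
  have hKolk : ∀ ℓ, D.Kol ℓ → kolPrime W K (L + L) ℓ := fun ℓ hℓ ↦ ((hDKol ℓ).mp hℓ).2.2
  -- ### the map `f` and the local compatibility `hA`
  obtain ⟨f, hf, hf₁, hf₂⟩ := exists_pairOfRat W K h2 hθ hd (L + L) hnoTors
  have hA : ∀ ℓ, D.Kol ℓ → ∀ v, v ∈ D.toSplitData.A ℓ ↔
      f v ∈ pairA (N := W.conductorNorm ℤ) W (sigmaQ K h2 hθ hd) (L + L) 1 ℓ := by
    intro ℓ hℓ v
    obtain ⟨hG, -, hk⟩ := (hDKol ℓ).mp hℓ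
    obtain ⟨hℓp, -, -, hgood, hfrobM, -⟩ := hk
    exact mem_toSplitData_A_iff_mem_pairA W hK hoddK hΔ h2 hθ hd (by omega) D hDA₁ hDA₂ f hf₁ hf₂ hG hgood
      hfrobM v
  -- ### finiteness of the two Selmer groups (Silverman X.4.2 (b))
  haveI : Finite (selmerGroup W (lvl (L + L))) := W.finite_selmerGroup_holds (lvl_ne_zero (L + L))
  haveI : Finite (selmerGroup (twin W K) (lvl (L + L))) := (twin W K).finite_selmerGroup_holds (lvl_ne_zero (L + L))
  -- ### the abstract side, rank-one member: `x₁ = D.x`, `ker ι₁ = ℤ x₁`, `ord x₁ = exp Sel` (from `D.x_ord`)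
  have hxSel : D.x ∈ selmerGroup W (lvl (L + L)) := by rw [← hDSel₁]; exact D.x_mem
  set x₁ : selmerGroup W (lvl (L + L)) := ⟨D.x, hxSel⟩ with hx₁def
  have hx₁ : (x₁ : galH1Torsion W (lvl (L + L))) = D.x := rfl
  have hker' : ι₁.ker = AddSubgroup.zmultiples x₁ := by
    ext z
    rw [AddMonoidHom.mem_ker, hker, AddSubgroup.mem_zmultiples_iff, AddSubgroup.mem_zmultiples_iff]
    constructor
    · rintro ⟨a, ha⟩
      exact ⟨a, Subtype.ext (by rw [AddSubgroupClass.coe_zsmul, hx₁, ha])⟩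
    · rintro ⟨a, ha⟩
      exact ⟨a, by rw [← ha, AddSubgroupClass.coe_zsmul, hx₁]⟩
  have hxord : addOrderOf x₁ = AddMonoid.exponent (selmerGroup W (lvl (L + L))) := by
    have hordx : addOrderOf D.x = 2 ^ (L + L) := by
      have h := D.toSplitData.addOrderOf_eq_pow_expo D.toSplitData.x
      rw [D.toSplitData.expo_x_and_zsmul_x_eq_zero_iff.1, PairDataM.toSplitData_p, hDp, PairDataM.toSplitData_M, hDM,
        PairDataM.toSplitData_x, Prod.addOrderOf_mk, addOrderOf_zero, Nat.lcm_one_right] at h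
      exact h
    have hord₁ : addOrderOf x₁ = 2 ^ (L + L) := by rw [← AddSubgroup.addOrderOf_coe x₁, hx₁, hordx]
    have h1 : AddMonoid.exponent (selmerGroup W (lvl (L + L))) ∣ 2 ^ (L + L) := by
      refine AddMonoid.exponent_dvd_of_forall_nsmul_eq_zero fun s ↦ Subtype.ext ?_
      rw [AddSubgroupClass.coe_nsmul, ZeroMemClass.coe_zero, ← natCast_zsmul]
      exact zsmul_galH1Torsion_eq_zero W (lvl (L + L)) _
    have h2' : addOrderOf x₁ ∣ AddMonoid.exponent (selmerGroup W (lvl (L + L))) :=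
      AddMonoid.addOrder_dvd_exponent x₁
    rw [hord₁] at h2' ⊢
    exact Nat.dvd_antisymm h2' h1
  -- ### the abstract side: `ι₁` onto (Kummer exactness), `2^L · Sel(E^{(d_K)}) = 0` and nondegeneracy from `ι₂`
  have hι₁surj : Function.Surjective ι₁ := selmerToSha_surjective W ι₁ hι₁
  have hpB : ∀ v : selmerGroup (twin W K) (lvl (L + L)), 2 ^ L • v = 0 :=
    two_pow_smul_eq_zero_of_selmerToSha_injective (twin W K) ι₂ hι₂inj
  have hB₂nd := nondegenerate_pullback_of_selmerToSha_bijective (twin W K) ι₂ hι₂inj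
    (selmerToSha_surjective (twin W K) ι₂ hι₂) _ hCT₂nd
  exact card_mul_card_le_two_pow_two_mul_of_pairData_canonical W
    Literature.NumberTheory.Automorphic.chebotarev_artinRep_holds hK hoddK hρ hΔ hΔK h2 hθ hd hL1 hc₀ hzfix hcomm
    hS hP₀ hnoTors D hDp hDM hDSel₁ hDSel₂ hDLoc₁ hDLoc₂ hDA₁ hDA₂ hDpl hDDv hDKol hKolk hM₀L f hf hf₁ hf₂ hA hkill₁
    e₁ hμ₁ hadd₁₁ hadd₂₁ hgal₁ halt₁ hnondeg₁ ι₁ hι₁ hkill₂ e₂ hμ₂ hadd₁₂ hadd₂₂ hgal₂ halt₂ hnondeg₂ ι₂ hι₂ hι₁surj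
    x₁ hx₁ hker' hxord hB₁nd hB₂nd hpB

end Summit.BirchSwinnertonDyer.BirchSwinnertonDyer.Theorems.KolyvaginPairDataTwo

end
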